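import Summits.QuantumFields.YangMills.Theses.IsotropyFromPowerCounting
import Literature.MathematicalPhysics.QuantumFieldTheory.OSReconstructionNoE1

/-!
# Crux-ideate sketch (ideator 2, round 1) — crux `stmt-QuantumFields-18372`
`IsotropyFromPowerCounting.CurvatureSandwichBound` (Σ)

First lemmas of the three idea cards filed from this folder:

* §1 `IsSymm.norm_le_of_pow_growth` — THE HINGE (R1) shared by all three cards: for a symmetric
  endomorphism `Y` of a complex pre-Hilbert space and a vector `x`, geometric growth
  `‖Yᵐ x‖ ≤ c·Bᵐ` forces `‖Y x‖ ≤ B‖x‖` (Glimm–Jaffe 1987 (10.5.12), iterated Schwarz; no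
  completeness, no spectral theorem).  Applied to `Y = X♯X` (one period of a heat-sandwich chain on
  OS field vectors) it turns chain-growth bounds into the sandwich bound, and makes every spectator
  constant irrelevant.  PROVED below.
* §2 `strip_poisson_midline` (card `cone-subordination-sharp-from-smooth`): the midline value of a
  bounded analytic function on a strip is the `sech`-average of its two boundary lines (statement;
  complex analysis, M-sized) + the proved scalar cone contraction `exp_cone_contraction`.
* §3 `mirror_schwarz` (card `transverse-mirror-vacuum-growth`): the reflection-positivity Schwarz
  inequality in ANY OS-reconstructible frame, in the tree's `fieldVec` currency (proved, two lines) —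
  the brick that strips one-sided spectators.
-/

noncomputable section

namespace Summit.QuantumFields.YangMills.Cruxes.CurvatureSandwichBound.Ideation2

open scoped InnerProductSpace ComplexConjugate SchwartzMap
open Complex MeasureTheory
open Literature.MathematicalPhysics.QuantumLattice Literature.MathematicalPhysics.AQFT
  Literature.MathematicalPhysics.QuantumFieldTheory

/-! ## §1 The hinge: geometric growth of a symmetric operator's powers controls its norm -/

section Hinge

variable {E : Type*} [NormedAddCommGroup E] [InnerProductSpace ℂ E]

/-- A symmetric endomorphism of a (possibly incomplete) complex inner product space. -/
def IsSymm (Y : E →ₗ[ℂ] E) : Prop := ∀ x y : E, ⟪Y x, y⟫_ℂ = ⟪x, Y y⟫_ℂ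

theorem IsSymm.pow {Y : E →ₗ[ℂ] E} (hY : IsSymm Y) (n : ℕ) : IsSymm (Y ^ n) := by
  induction n with
  | zero => intro x y; simp
  | succ n ih =>
    intro x y
    calc ⟪(Y ^ (n + 1)) x, y⟫_ℂ = ⟪Y ((Y ^ n) x), y⟫_ℂ := by rw [pow_succ', Module.End.mul_apply]
      _ = ⟪(Y ^ n) x, Y y⟫_ℂ := hY _ _
      _ = ⟪x, (Y ^ n) (Y y)⟫_ℂ := ih _ _
      _ = ⟪x, (Y ^ (n + 1)) y⟫_ℂ := by rw [pow_succ, Module.End.mul_apply]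

/-- One Schwarz step: `‖Y z‖² = ⟪z, Y² z⟫ ≤ ‖z‖ ‖Y² z‖`. -/
theorem IsSymm.norm_sq_le {Y : E →ₗ[ℂ] E} (hY : IsSymm Y) (z : E) :
    ‖Y z‖ ^ 2 ≤ ‖z‖ * ‖(Y ^ 2) z‖ := by
  have h1 : (‖Y z‖ ^ 2 : ℝ) = RCLike.re ⟪Y z, Y z⟫_ℂ := (inner_self_eq_norm_sq (𝕜 := ℂ) (Y z)).symm
  have h2 : ⟪Y z, Y z⟫_ℂ = ⟪z, (Y ^ 2) z⟫_ℂ := by rw [hY, pow_two, Module.End.mul_apply]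
  rw [h1, h2]
  exact (RCLike.re_le_norm _).trans (norm_inner_le_norm _ _)

/-- Iterated Schwarz (Glimm–Jaffe 1987, (10.5.12)): `‖Y x‖^(2ʲ) ≤ ‖x‖^(2ʲ−1) ‖Y^(2ʲ) x‖`. -/
theorem IsSymm.norm_pow_two_pow_le {Y : E →ₗ[ℂ] E} (hY : IsSymm Y) (x : E) (j : ℕ) :
    ‖Y x‖ ^ (2 ^ j) ≤ ‖x‖ ^ (2 ^ j - 1) * ‖(Y ^ (2 ^ j)) x‖ := by
  induction j with
  | zero => simp
  | succ j ih =>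
    have step : ‖(Y ^ (2 ^ j)) x‖ ^ 2 ≤ ‖x‖ * ‖(Y ^ (2 ^ (j + 1))) x‖ := by
      have h := (hY.pow (2 ^ j)).norm_sq_le x
      rwa [← pow_mul, ← pow_succ] at h
    have h2 : 2 ^ (j + 1) = 2 * 2 ^ j := by ring
    have hj : 1 ≤ 2 ^ j := Nat.one_le_two_pow
    have harith : 2 * (2 ^ j - 1) + 1 = 2 ^ (j + 1) - 1 := by omega
    calc ‖Y x‖ ^ (2 ^ (j + 1)) = (‖Y x‖ ^ (2 ^ j)) ^ 2 := by rw [pow_succ, pow_mul]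
      _ ≤ (‖x‖ ^ (2 ^ j - 1) * ‖(Y ^ (2 ^ j)) x‖) ^ 2 := by gcongr
      _ = ‖x‖ ^ (2 * (2 ^ j - 1)) * ‖(Y ^ (2 ^ j)) x‖ ^ 2 := by ring
      _ ≤ ‖x‖ ^ (2 * (2 ^ j - 1)) * (‖x‖ * ‖(Y ^ (2 ^ (j + 1))) x‖) := by gcongr
      _ = ‖x‖ ^ (2 * (2 ^ j - 1) + 1) * ‖(Y ^ (2 ^ (j + 1))) x‖ := by rw [pow_succ]; ring
      _ = ‖x‖ ^ (2 ^ (j + 1) - 1) * ‖(Y ^ (2 ^ (j + 1))) x‖ := by rw [harith]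

/-- **R1 (the hinge).**  Geometric growth of `‖Yᵐ x‖` forces `‖Y x‖ ≤ B ‖x‖` — pointwise in `x`,
for a symmetric `Y` on a pre-Hilbert space.  (In the cards: `Y = X♯X`, one period of a sandwich
chain acting on OS field vectors; the hypothesis is a bound on Schwinger functions of long periodic
chains with the spectator `x` at both ends, and the constant `c` — all the spectator dependence —
drops out.) -/
theorem IsSymm.norm_le_of_pow_growth {Y : E →ₗ[ℂ] E} (hY : IsSymm Y) {B c : ℝ} (hB : 0 ≤ B)
    (x : E) (hx : ∀ m : ℕ, ‖(Y ^ m) x‖ ≤ c * B ^ m) : ‖Y x‖ ≤ B * ‖x‖ := by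
  by_contra hlt
  push Not at hlt
  have hx0 : 0 < ‖x‖ := by
    rcases (norm_nonneg x).eq_or_lt with h | h
    · exfalso
      have hx' : x = 0 := norm_eq_zero.mp h.symm
      subst hx'
      simp at hlt
    · exact h
  -- `‖Y x‖^(2^j) ≤ (c/‖x‖) · (B‖x‖)^(2^j)` for every `j`
  have main : ∀ j : ℕ, ‖Y x‖ ^ (2 ^ j) ≤ (c / ‖x‖) * (B * ‖x‖) ^ (2 ^ j) := by
    intro j
    have hj : 1 ≤ 2 ^ j := Nat.one_le_two_pow
    calc ‖Y x‖ ^ (2 ^ j) ≤ ‖x‖ ^ (2 ^ j - 1) * ‖(Y ^ (2 ^ j)) x‖ := hY.norm_pow_two_pow_le x j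
      _ ≤ ‖x‖ ^ (2 ^ j - 1) * (c * B ^ (2 ^ j)) := by gcongr; exact hx _
      _ = (c / ‖x‖) * (B * ‖x‖) ^ (2 ^ j) := by
          rw [mul_pow]
          have : ‖x‖ ^ (2 ^ j) = ‖x‖ ^ (2 ^ j - 1) * ‖x‖ := by
            rw [← pow_succ, Nat.sub_add_cancel hj]
          rw [this]
          field_simp
  set s : ℝ := B * ‖x‖ with hs
  have hs0 : 0 ≤ s := mul_nonneg hB (norm_nonneg x)
  rcases hs0.eq_or_lt with hszero | hspos
  · -- `s = 0`: take `j = 0`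
    have h0 := main 0
    simp only [pow_zero, pow_one] at h0
    rw [← hszero, mul_zero] at h0
    rw [← hszero] at hlt
    linarith
  · -- `s > 0`: the ratio `r = ‖Y x‖ / s > 1` has bounded powers, absurd
    set r : ℝ := ‖Y x‖ / s with hr
    have hr1 : 1 < r := by rw [hr, one_lt_div hspos]; simpa [hs] using hlt
    have hbdd : ∀ j : ℕ, r ^ (2 ^ j) ≤ c / ‖x‖ := by
      intro j
      rw [hr, div_pow, div_le_iff₀ (pow_pos hspos _)]
      simpa [hs] using main j
    obtain ⟨n, hn⟩ := ((tendsto_pow_atTop_atTop_of_one_lt hr1).eventually_gt_atTop (c / ‖x‖)).exists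
    have hmono : r ^ n ≤ r ^ (2 ^ n) :=
      pow_le_pow_right₀ hr1.le (Nat.lt_two_pow_self).le
    exact (lt_irrefl _) ((hn.trans_le hmono).trans_le (hbdd n))

end Hinge

/-! ## §2 Card `cone-subordination-sharp-from-smooth`: the strip Poisson formula and the cone contraction -/

section Strip

/-- **Strip Poisson formula at the midline** (harmonic measure of the strip `|Im z| < s` seen from
`0` has density `sech(πb/2s)/(4s)` on each boundary line).  For `f` analytic on a slightly larger
open strip and bounded on the closed one, `f 0` is the `sech`-average of its values on the two lines
`Im z = ∓s`.  In the card, `f(z) = ⟨Ψ', e^{-uH} φ(f₁ translated by z·e₁) e^{-vH} Ψ⟩`, `s < min(u,v)`,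
and the two boundary terms are sandwiches of the `sech`-SMEARED insertion conjugated by
`e^{±sP₁}`, which the cone `H ≥ |P₁|` absorbs into `e^{-s(H∓P₁)}`-contractions. -/
theorem strip_poisson_midline {f : ℂ → ℂ} {s s' M : ℝ} (hs : 0 < s) (hss' : s < s')
    (hf : DifferentiableOn ℂ f {z : ℂ | |z.im| < s'}) (hM : ∀ z : ℂ, |z.im| ≤ s → ‖f z‖ ≤ M) :
    f 0 = ∫ b : ℝ, ((Real.cosh (Real.pi * b / (2 * s)))⁻¹ / (4 * s) : ℝ) •
      (f ((b : ℂ) - (s : ℂ) * I) + f ((b : ℂ) + (s : ℂ) * I)) := by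
  sorry

/-- The scalar shadow of the cone contraction used after the strip formula: on the joint spectrum
`{(E, p) : |p| ≤ E}` of `(H, P₁)`, `e^{-uE} e^{sp} ≤ e^{-(u-s)E}` for `0 ≤ s`, i.e.
`‖e^{-uH} e^{sP₁}‖ ≤ ‖e^{-(u-s)H}‖` by functional calculus of the joint spectral measure
(`OSReconstructionNoE1.IsJointSpectralMeasure`). -/
theorem exp_cone_contraction {E p u s : ℝ} (hcone : |p| ≤ E) (hs : 0 ≤ s) :
    Real.exp (-(u * E)) * Real.exp (s * p) ≤ Real.exp (-((u - s) * E)) := by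
  rw [← Real.exp_add]
  apply Real.exp_le_exp.mpr
  have hp : p ≤ E := (le_abs_self p).trans hcone
  nlinarith

end Strip

/-! ## §3 Card `transverse-mirror-vacuum-growth`: the Schwarz brick in any frame -/

section Mirror

variable {ι : Type*} {d : ℕ} [NeZero d]

/-- **Mirror Schwarz inequality** in the `fieldVec` currency, for ANY OS-reconstructible labelled
family `T` — in the card `T` is the curvature channel read in a TRANSVERSE frame (time := `x₂`,
available from proper-hypercubic invariance + E2 of `W1`), `A` = the mirror image of the sheet chain
(on one side of the mirror), `B` = the spectator clouds `θW̄ ⊗ W` (on the other side):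
`|𝔖(θĀ ⊗ B)| ≤ ‖Ψ(A)‖ ‖Ψ(B)‖`, and `‖Ψ(A)‖² = 𝔖(chain ⊗ mirrored chain)` is a VACUUM quantity while
`‖Ψ(B)‖` does not depend on the chain length. -/
theorem mirror_schwarz {T : LabelledSchwingerFamily ι (EuclideanSpace ℝ (Fin d))}
    (h : OSReconstructionNoE1 T) {n m : ℕ} (k : Fin n → ι) (k' : Fin m → ι)
    {A : 𝓢((Fin n → EuclideanSpace ℝ (Fin d)), ℂ)} {B : 𝓢((Fin m → EuclideanSpace ℝ (Fin d)), ℂ)}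
    (hA : IsTimeOrdered A) (hB : IsTimeOrdered B)
    {H : 𝓢((Fin (n + m) → EuclideanSpace ℝ (Fin d)), ℂ)} (hH : IsAppendTensorOf H (osAdjoint A) B) :
    ‖T (n + m) (Fin.append (k ∘ Fin.rev) k') H‖ ≤ ‖h.fieldVec n k A hA‖ * ‖h.fieldVec m k' B hB‖ := by
  rw [← h.inner_fieldVec_fieldVec k k' hA hB hH]
  exact norm_inner_le_norm _ _

/-- **Growth transfer** (the arithmetic of the card, stated over real sequences so that it is
checkable now): if every spectator'd chain value is bounded by `K^{1/2}` times the square root of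
the vacuum mirror-chain value (`mirror_schwarz`), and the vacuum mirror-chain values grow at most
like `c · B^(2m)`, then the spectator'd chain grows at most like `(K c)^{1/2} · Bᵐ` — the input
shape of `IsSymm.norm_le_of_pow_growth`. -/
theorem sector_growth_of_vacuum_growth {a v : ℕ → ℝ} {K c B : ℝ} (hK : 0 ≤ K) (hc : 0 ≤ c)
    (hB : 0 ≤ B) (hv : ∀ m, 0 ≤ v m) (hschwarz : ∀ m, a m ≤ Real.sqrt K * Real.sqrt (v m))
    (hvac : ∀ m, v m ≤ c * B ^ (2 * m)) : ∀ m, a m ≤ Real.sqrt (K * c) * B ^ m := by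
  intro m
  calc a m ≤ Real.sqrt K * Real.sqrt (v m) := hschwarz m
    _ ≤ Real.sqrt K * Real.sqrt (c * B ^ (2 * m)) := by gcongr; exact hvac m
    _ = Real.sqrt (K * c) * B ^ m := by
        rw [pow_mul', Real.sqrt_mul hc, Real.sqrt_sq (pow_nonneg hB _), Real.sqrt_mul hK]
        ring

end Mirror

end Summit.QuantumFields.YangMills.Cruxes.CurvatureSandwichBound.Ideation2

end
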